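import Literature.MathematicalPhysics.QuantumFieldTheory.Balaban1983to89.Beta.BalabanStepJetsSucc
import Literature.MathematicalPhysics.QuantumFieldTheory.Balaban1983to89.Beta.StepDriftWitness
import Summits.QuantumFields.BalabanUV.Beta.TameKernelCalculus
import Summits.QuantumFields.BalabanUV.Beta.GAN24.WoodburyFibreBlocks

/-!
# GAN24 / WoodburyFibreZeroModeGain — the ZERO-MODE (CONSTRAINT-ORTHOGONALITY) GAIN of a fluctuation block: a kernel that
# annihilates the block constants gains, in every composition, the OSCILLATION of the other leg over the blocks
# (census row V14 of `HOME/b2b-balaban-gan24-p3/WOODBURY-FIBRE.md` v8; binder row G-an2-4 ∕ (CONV-C), prover part P3, gen 8)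

Cell `pub-balaban`, β sub-cell.  HONEST FRAMING (verbatim): discharging `BetaPertH` makes Bałaban's UV stability UNCONDITIONAL — a real
constructive-QFT result; it is NOT the continuum limit and NOT the Clay problem.  HONEST DEPENDENCY (verbatim): continuum YM on T⁴ ⇐
BetaPertH ∧ nine spine estimates (0/9 proved); BetaPertH ⇐ (D1) ∧ (D4) ∧ CAP+tail; G-an2-4 gates asym, D1 and NE2/3/4.  NOT IN PRINT; OUR
BOOKKEEPING.  [folklore] lattice-sum algebra over an2's `ExpKernelCalculus` currency (`MKer`, `Decays`, `comp`, `Zl`), pv∕an1's block and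
straight-contour sums (`AffineAveraging.blockSum` ∕ `contourSum`, `AffineReproduction.contourSumAdj`, `KKTFluctuationEnergy.tsum_mul_eq_zero_of_blockConst`
∕ `lip1_contourSumAdj` BY NAME), an2's `BalabanStepJetsSucc.decays_comp` ∕ `StepDriftWitness.comp_zero_right` and an5's `TameKernelCalculus`; cites nothing, mints no `def … : Prop`, instantiates no wall binder.  It
discharges NOTHING of (CONV-C), of the W-slot (hW, hWall), of «T2Shape», of (D1); NEVER «G-an2-4 closed»; NOT BetaPertH, NOT continuum, NOT Clay.

## Why (context only; asserted nowhere below)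

The W∕T₂-slot planning note of the G-an2-4 swarm (journal 2026-08-20 l.6956, leaf-14-g21, question (Q1)) asks which typed object
carries the factor `θ^{n−m}` of a level-`m` insertion read at level `n` through the FIELD–FIELD block of the packed resolvent, and
locates the mechanism: «the fluctuation covariance kills block-constant currents» (the KKT identity `Q·Γ = 0`, in the tree as
`PropagatorWoodburyFibre.constraint_mul_flucCov` (matrices) and `KKTFluctuationKernel.Gam_Q` (an2's kernel `Γ` on `ℤ^{d+1}`: zero
straight-contour sums)) «combined with a discrete-gradient bound on the soft composite legs».  This file types the first half as an
ENGINE and the interface to the second half: if `Γ` annihilates a reference kernel `J₀` built from `J` by sampling `J` on the zero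
modes (`comp Γ J₀ = 0`), then `comp Γ J = comp Γ (J − J₀)` and the `Decays` constant of the composition is `|F|·C_Γ·ω·Zl`, where
`ω` is the `Decays` constant of the OSCILLATION `J − J₀` — not the size of `J`.  For block constants (`blockSum`) the reference is the
block-corner sample `blockRef N J y := J (N•quo_N y)`; for Bałaban's 1-form averaging (`contourSum`) it is the contour quasi-interpolant
`contourRef N J y (inl κ) := N⁻¹·Σ_{s<N} J (N•quo_N (y − s e_κ)) (inl κ)` (= `N⁻¹·contourSumAdj` of the coarse samples).  The legs'
oscillation (`ω ~ Lc^{−(n−m)}` for a level-`n`-smooth leg, from a forward-difference bound) is the CONSUMER's input; nothing about it is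
claimed here.

## Contents (all [folklore])
* §1 ABSTRACT GAIN (any dimension `D`, finite fibre `F`): `summable_slice_of_rowMaj_bdd` ∕ `_of_bdd_colMaj`; **`decays_comp_of_annihil_right`**
  (`comp Γ J₀ = 0`, `Decays Γ C_Γ δ`, `Decays (J − J₀) ω δ` ⇒ `Decays (comp Γ J) (|F|·C_Γ·ω·Zl_D(δ−δ′)) δ′`), **`decays_comp_of_annihil_left`**,
  and the TWO-SIDED DOUBLE GAIN **`decays_comp_comp_of_annihil`** (`comp A₀ Γ = 0 = comp Γ B₀` ⇒ constant ∝ `ω_A·C_Γ·ω_B`).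
* §2 SCALAR BLOCK ZERO MODES: `blockRef`, `blockRefL`; **`comp_blockRef_eq_zero`** (zero `blockSum`s of `Γ` in its second variable ⇒
  `comp Γ (blockRef N J) = 0`, `tsum_mul_eq_zero_of_blockConst` BY NAME), **`comp_blockRefL_eq_zero`**.
* §3 BAŁABAN'S STRAIGHT-CONTOUR ZERO MODES on the fibre `Fib d = (field directions) ⊕ (multiplier directions)`: `contourRef`, `contourRefL`
  (field rows re-sampled, multiplier rows untouched); **`comp_contourRef_eq_zero`** (zero `contourSum`s of the field columns of `Γ` and no
  multiplier columns ⇒ `comp Γ (contourRef N J) = 0`, `lip1_contourSumAdj` BY NAME), **`comp_contourRefL_eq_zero`**.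
* The INSTANCE `blockFF (KInv N)` (an2's packed one-step resolvent, field–field block: zero contour sums on BOTH legs from `Gam_Q` +
  `KInv_inl_inl_symm`, and the one- and two-sided gains for `Γ_N^{ff}`) is the companion file `GAN24/WoodburyFibreZeroModeGainKInv`.
-/

noncomputable section

open Finset
open scoped BigOperators
open Literature.MathematicalPhysics.QuantumFieldTheory
open Literature.MathematicalPhysics.QuantumFieldTheory.Balaban1983to89
open Literature.MathematicalPhysics.QuantumFieldTheory.Balaban1983to89.Beta
open B12Sec2to5 (l1 l1_nonneg)
open ExpKernelCalculus (MKer Decays comp Zl)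
open KernelWard (Bdd bdd_of_decays comp_sub_right comp_sub_left)
open BalabanStepJetsSucc (decays_comp)
open StepDriftWitness (comp_zero_right)
open Summit.QuantumFields.BalabanUV.Beta.TameKernelCalculus (Tame RowMaj ColMaj Spr comp_assoc_tame)
open AffineAveraging (Form0 Form1 box toSite blockSum contourSum unitVec)
open AffineReproduction (contourSumAdj IsBlockConst)
open LatticeForm (quo)
open KKTFluctuationEnergy (tsum_mul_eq_zero_of_blockConst lip1 lip1_contourSumAdj summable_mul_of_bdd' quo_zsmul_add_toSite)
open OneStepResolventKernel (Fib bound_mono)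

namespace Summit.QuantumFields.BalabanUV.Beta.GAN24.WoodburyFibreZeroModeGain

/-! ## §1 The abstract zero-mode gain -/

section Abstract

variable {D : ℕ} {F : Type*} [Fintype F]

omit [Fintype F] in
/-- A row-majorised kernel has summable rows. [folklore] -/
theorem summable_row_of_rowMaj {Γ : MKer D F} (hΓ : RowMaj Γ) (x : Fin D → ℤ) (a f : F) :
    Summable fun y : Fin D → ℤ => Γ x y a f := by
  obtain ⟨φ, hφ, -, hle⟩ := hΓ x
  exact Summable.of_norm_bounded hφ (fun y => by rw [Real.norm_eq_abs]; exact hle y a f)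

omit [Fintype F] in
/-- A column-majorised kernel has summable columns. [folklore] -/
theorem summable_col_of_colMaj {Γ : MKer D F} (hΓ : ColMaj Γ) (z : Fin D → ℤ) (f b : F) :
    Summable fun y : Fin D → ℤ => Γ y z f b := by
  obtain ⟨ψ, hψ, -, hle⟩ := hΓ z
  exact Summable.of_norm_bounded hψ (fun y => by rw [Real.norm_eq_abs]; exact hle y f b)

/-- A middle-leg slice `y ↦ Σ_f Γ(x,y)_{af}·K(y,z)_{fb}` is summable when `Γ` has summable row majorants and `K` is bounded. [folklore] -/
theorem summable_slice_of_rowMaj_bdd {Γ K : MKer D F} (hΓ : RowMaj Γ) {B : ℝ} (hK : Bdd K B) (x z : Fin D → ℤ) (a b : F) :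
    Summable fun y : Fin D → ℤ => ∑ f, Γ x y a f * K y z f b := by
  obtain ⟨φ, hφ, hφ0, hle⟩ := hΓ x
  refine summable_sum fun f _ => Summable.of_norm_bounded (hφ.mul_right B) (fun y => ?_)
  rw [Real.norm_eq_abs, abs_mul]
  exact mul_le_mul (hle y a f) (hK y z f b) (abs_nonneg _) (hφ0 y)

/-- A middle-leg slice `y ↦ Σ_f A(x,y)_{af}·Γ(y,z)_{fb}` is summable when `A` is bounded and `Γ` has summable column majorants. [folklore] -/
theorem summable_slice_of_bdd_colMaj {A Γ : MKer D F} {B : ℝ} (hA : Bdd A B) (hΓ : ColMaj Γ) (x z : Fin D → ℤ) (a b : F) :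
    Summable fun y : Fin D → ℤ => ∑ f, A x y a f * Γ y z f b := by
  obtain ⟨ψ, hψ, hψ0, hle⟩ := hΓ z
  refine summable_sum fun f _ => Summable.of_norm_bounded (hψ.mul_left B) (fun y => ?_)
  rw [Real.norm_eq_abs, abs_mul]
  exact mul_le_mul (hA x y a f) (hle y f b) (abs_nonneg _) ((abs_nonneg _).trans (hA x y a f))

/-- **ZERO-MODE GAIN, RIGHT LEG.**  If `Γ` annihilates a reference kernel `J₀` (`comp Γ J₀ = 0`), then `comp Γ J = comp Γ (J − J₀)`, so the
`Decays` constant of `comp Γ J` is `|F|·C_Γ·ω·Zl_D(δ − δ′)` with `ω` the constant of the OSCILLATION `J − J₀` (not the size of `J`). [folklore] -/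
theorem decays_comp_of_annihil_right {Γ J J₀ : MKer D F} {CΓ ω δ δ' BJ B₀ : ℝ} (hΓr : RowMaj Γ) (hJ : Bdd J BJ) (hJ₀ : Bdd J₀ B₀)
    (h0 : comp Γ J₀ = 0) (hΓ : Decays Γ CΓ δ) (hω : Decays (J - J₀) ω δ) (hδ'0 : 0 ≤ δ') (hδ' : δ' < δ) :
    Decays (comp Γ J) ((Fintype.card F : ℝ) * (CΓ * ω) * Zl D (δ - δ')) δ' := by
  have hsplit : comp Γ J = comp Γ (J - J₀) := by
    rw [comp_sub_right (summable_slice_of_rowMaj_bdd hΓr hJ) (summable_slice_of_rowMaj_bdd hΓr hJ₀), h0, sub_zero]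
  rw [hsplit]
  exact decays_comp hΓ hω hδ'0 hδ'

/-- **ZERO-MODE GAIN, LEFT LEG.**  If `comp A₀ Γ = 0` then `comp A Γ = comp (A − A₀) Γ` and the constant is `|F|·ω·C_Γ·Zl_D(δ − δ′)`. [folklore] -/
theorem decays_comp_of_annihil_left {A A₀ Γ : MKer D F} {CΓ ω δ δ' BA B₀ : ℝ} (hA : Bdd A BA) (hA₀ : Bdd A₀ B₀) (hΓc : ColMaj Γ)
    (h0 : comp A₀ Γ = 0) (hω : Decays (A - A₀) ω δ) (hΓ : Decays Γ CΓ δ) (hδ'0 : 0 ≤ δ') (hδ' : δ' < δ) :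
    Decays (comp A Γ) ((Fintype.card F : ℝ) * (ω * CΓ) * Zl D (δ - δ')) δ' := by
  have hsplit : comp A Γ = comp (A - A₀) Γ := by
    rw [comp_sub_left (summable_slice_of_bdd_colMaj hA hΓc) (summable_slice_of_bdd_colMaj hA₀ hΓc), h0, sub_zero]
  rw [hsplit]
  exact decays_comp hω hΓ hδ'0 hδ'

/-- **TWO-SIDED DOUBLE GAIN.**  `comp A₀ Γ = 0 = comp Γ B₀` ⇒ `comp (comp A Γ) B = comp (comp (A − A₀) Γ) (B − B₀)`, so the constant of
`A∘Γ∘B` carries BOTH oscillations: `|F|²·ω_A·C_Γ·ω_B·Zl_D(δ−δ′)·Zl_D(δ′−δ″)` at any rate `δ″ < δ′ < δ` (`0 < δ′`).  Tameness of the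
reference `B₀` (`Spr B₀`) is needed for the re-association `(A−A₀)∘Γ∘B₀ = (A−A₀)∘(Γ∘B₀)`. [folklore] -/
theorem decays_comp_comp_of_annihil {A A₀ Γ B B₀ : MKer D F} {CΓ ωA ωB δ δ' δ'' BA BA₀ BB : ℝ}
    (hA : Bdd A BA) (hA₀ : Bdd A₀ BA₀) (hΓ : Decays Γ CΓ δ) (hδ : 0 < δ) (hB : Bdd B BB) (hB₀ : Spr B₀)
    (hA0 : comp A₀ Γ = 0) (hB0 : comp Γ B₀ = 0) (hωA : Decays (A - A₀) ωA δ) (hωB : Decays (B - B₀) ωB δ) (hωB0 : 0 ≤ ωB)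
    (hδ'0 : 0 < δ') (hδ' : δ' < δ) (hδ''0 : 0 ≤ δ'') (hδ'' : δ'' < δ') :
    Decays (comp (comp A Γ) B)
      ((Fintype.card F : ℝ) * (((Fintype.card F : ℝ) * (ωA * CΓ) * Zl D (δ - δ')) * ωB) * Zl D (δ' - δ'')) δ'' := by
  have hΓs : Spr Γ := ⟨CΓ, δ, hδ, hΓ⟩
  have hX : Decays (comp A Γ) ((Fintype.card F : ℝ) * (ωA * CΓ) * Zl D (δ - δ')) δ' :=
    decays_comp_of_annihil_left hA hA₀ hΓs.tame.2.1 hA0 hωA hΓ hδ'0.le hδ'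
  have hXs : Spr (comp A Γ) := ⟨_, δ', hδ'0, hX⟩
  obtain ⟨BB₀, hBB₀⟩ := hB₀.tame.2.2
  have hX0 : comp (comp A Γ) B₀ = 0 := by
    have hsplit : comp A Γ = comp (A - A₀) Γ := by
      rw [comp_sub_left (summable_slice_of_bdd_colMaj hA hΓs.tame.2.1) (summable_slice_of_bdd_colMaj hA₀ hΓs.tame.2.1),
        hA0, sub_zero]
    have hAs : Spr (A - A₀) := ⟨ωA, δ, hδ, hωA⟩
    rw [hsplit, ← comp_assoc_tame hAs.tame hΓs.tame hB₀.tame, hB0, comp_zero_right]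
  exact decays_comp_of_annihil_right hXs.tame.1 hB hBB₀ hX0 hX
    (fun x y a b => bound_mono (hωB x y a b) hωB0 le_rfl hδ'.le (l1_nonneg _)) hδ''0 hδ''

end Abstract

/-! ## §2 Scalar block zero modes: zero block sums ⇒ the block-corner sample is annihilated -/

section Blocks

variable {D : ℕ} {F : Type*} [Fintype F] {N : ℕ} [NeZero N]

omit [Fintype F] in
/-- The block index of a coarse point: `quo N (N•u) = u` (any dimension). [folklore] -/
theorem quo_zsmul_self (u : Fin D → ℤ) : quo N ((N : ℤ) • u) = u := by
  funext j
  simp only [quo, Pi.smul_apply, smul_eq_mul]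
  exact Int.mul_ediv_cancel_left _ (by exact_mod_cast NeZero.ne N)

/-- The BLOCK-CORNER SAMPLE of a right leg: `J` read at the corner `N•quo_N y` of the block of its first (contracted) variable. [folklore] -/
def blockRef (N : ℕ) (J : MKer D F) : MKer D F := fun y z f b => J ((N : ℤ) • quo N y) z f b

/-- The BLOCK-CORNER SAMPLE of a left leg: `A` read at the corner of the block of its second (contracted) variable. [folklore] -/
def blockRefL (N : ℕ) (A : MKer D F) : MKer D F := fun x y a f => A x ((N : ℤ) • quo N y) a f

omit [Fintype F] [NeZero N] in
/-- The block-corner sample is bounded by the bound of `J`. [folklore] -/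
theorem bdd_blockRef {J : MKer D F} {B : ℝ} (hJ : Bdd J B) : Bdd (blockRef N J) B :=
  fun y z f b => hJ ((N : ℤ) • quo N y) z f b

omit [Fintype F] [NeZero N] in
/-- The block-corner sample is bounded by the bound of `A`. [folklore] -/
theorem bdd_blockRefL {A : MKer D F} {B : ℝ} (hA : Bdd A B) : Bdd (blockRefL N A) B :=
  fun x y a f => hA x ((N : ℤ) • quo N y) a f

omit [Fintype F] in
/-- A block-corner sample is block-constant in the sampled variable. [folklore] -/
theorem isBlockConst_blockRef (J : MKer D F) (z : Fin D → ℤ) (f b : F) :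
    IsBlockConst N (fun y => blockRef N J y z f b) := by
  intro u c hc
  simp only [blockRef, quo_zsmul_add_toSite (N := N) u hc, quo_zsmul_self]

/-- **ZERO BLOCK SUMS ANNIHILATE THE BLOCK-CORNER SAMPLE (right leg).**  If every row of `Γ` has zero block sums in its second variable,
then `comp Γ (blockRef N J) = 0` for every bounded `J` (pv∕an1's M∕G complementarity `tsum_mul_eq_zero_of_blockConst`). [folklore] -/
theorem comp_blockRef_eq_zero {Γ J : MKer D F} (hΓr : RowMaj Γ) {B : ℝ} (hJ : Bdd J B)
    (hZ : ∀ x a f u, blockSum N (fun y => Γ x y a f) u = 0) : comp Γ (blockRef N J) = 0 := by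
  funext x z a b
  show (∑' y, ∑ f, Γ x y a f * blockRef N J y z f b) = 0
  rw [Summable.tsum_finsetSum (fun f _ => (show Summable (fun y => Γ x y a f * blockRef N J y z f b) from
    summable_mul_of_bdd' (summable_row_of_rowMaj hΓr x a f) (fun y => bdd_blockRef (N := N) hJ y z f b)))]
  refine Finset.sum_eq_zero fun f _ => ?_
  have h := tsum_mul_eq_zero_of_blockConst (N := N) (fun y => bdd_blockRef (N := N) hJ y z f b) (isBlockConst_blockRef (N := N) J z f b)
    (summable_row_of_rowMaj hΓr x a f) (hZ x a f)
  simpa only [mul_comm] using h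

/-- **ZERO BLOCK SUMS ANNIHILATE THE BLOCK-CORNER SAMPLE (left leg).**  If every column of `Γ` has zero block sums in its first variable,
then `comp (blockRefL N A) Γ = 0` for every bounded `A`. [folklore] -/
theorem comp_blockRefL_eq_zero {A Γ : MKer D F} {B : ℝ} (hA : Bdd A B) (hΓc : ColMaj Γ)
    (hZ : ∀ z f b u, blockSum N (fun y => Γ y z f b) u = 0) : comp (blockRefL N A) Γ = 0 := by
  funext x z a b
  show (∑' y, ∑ f, blockRefL N A x y a f * Γ y z f b) = 0
  rw [Summable.tsum_finsetSum (fun f _ => ?_)]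
  · refine Finset.sum_eq_zero fun f _ => ?_
    have hc : IsBlockConst N (fun y => blockRefL N A x y a f) := by
      intro u c hc
      simp only [blockRefL, quo_zsmul_add_toSite (N := N) u hc, quo_zsmul_self]
    exact tsum_mul_eq_zero_of_blockConst (N := N) (fun y => bdd_blockRefL (N := N) hA x y a f) hc
      (summable_col_of_colMaj hΓc z f b) (hZ z f b)
  · have h := summable_mul_of_bdd' (summable_col_of_colMaj hΓc z f b) (fun y => bdd_blockRefL (N := N) hA x y a f)
    simpa only [mul_comm] using h

/-- **PACKAGED (right leg)**: zero block sums of `Γ` + oscillation `ω` of `J` over the blocks ⇒ gain. [folklore] -/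
theorem decays_comp_of_blockSum_eq_zero {Γ J : MKer D F} {CΓ ω δ δ' B : ℝ} (hΓ : Decays Γ CΓ δ) (hδ : 0 < δ) (hJ : Bdd J B)
    (hZ : ∀ x a f u, blockSum N (fun y => Γ x y a f) u = 0) (hω : Decays (J - blockRef N J) ω δ) (hδ'0 : 0 ≤ δ') (hδ' : δ' < δ) :
    Decays (comp Γ J) ((Fintype.card F : ℝ) * (CΓ * ω) * Zl D (δ - δ')) δ' :=
  have hΓs : Spr Γ := ⟨CΓ, δ, hδ, hΓ⟩
  decays_comp_of_annihil_right hΓs.tame.1 hJ (bdd_blockRef hJ) (comp_blockRef_eq_zero hΓs.tame.1 hJ hZ) hΓ hω hδ'0 hδ'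

/-- **PACKAGED (left leg)**. [folklore] -/
theorem decays_comp_of_blockSum_eq_zero_left {A Γ : MKer D F} {CΓ ω δ δ' B : ℝ} (hA : Bdd A B) (hΓ : Decays Γ CΓ δ) (hδ : 0 < δ)
    (hZ : ∀ z f b u, blockSum N (fun y => Γ y z f b) u = 0) (hω : Decays (A - blockRefL N A) ω δ) (hδ'0 : 0 ≤ δ') (hδ' : δ' < δ) :
    Decays (comp A Γ) ((Fintype.card F : ℝ) * (ω * CΓ) * Zl D (δ - δ')) δ' :=
  have hΓs : Spr Γ := ⟨CΓ, δ, hδ, hΓ⟩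
  decays_comp_of_annihil_left hA (bdd_blockRefL hA) hΓs.tame.2.1 (comp_blockRefL_eq_zero hA hΓs.tame.2.1 hZ) hω hΓ hδ'0 hδ'

end Blocks

/-! ## §3 Bałaban's straight-contour zero modes on the fibre `Fib d` -/

section Contour

variable {d : ℕ} {N : ℕ} [NeZero N]

/-- The CONTOUR QUASI-INTERPOLANT of a right leg: its field rows (`inl κ`) replaced by the average over the `N` straight contours of
direction `κ` through the point of the coarse samples `J (N•quo_N (y − s e_κ))`, i.e. `N⁻¹·contourSumAdj` of the samples; multiplier rows
untouched.  `J − contourRef N J` is the oscillation of the field rows of `J` on the scale `N`. [folklore] -/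
def contourRef (N : ℕ) (J : MKer (d + 1) (Fib d)) : MKer (d + 1) (Fib d) := fun y z f b =>
  match f with
  | Sum.inl κ => (N : ℝ)⁻¹ * ∑ s ∈ Finset.range N, J ((N : ℤ) • quo N (y - (s : ℤ) • unitVec κ)) z (Sum.inl κ) b
  | Sum.inr κ => J y z (Sum.inr κ) b

/-- The CONTOUR QUASI-INTERPOLANT of a left leg (field columns `inl κ` of the contracted second variable re-sampled). [folklore] -/
def contourRefL (N : ℕ) (A : MKer (d + 1) (Fib d)) : MKer (d + 1) (Fib d) := fun x y a f =>
  match f with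
  | Sum.inl κ => (N : ℝ)⁻¹ * ∑ s ∈ Finset.range N, A x ((N : ℤ) • quo N (y - (s : ℤ) • unitVec κ)) a (Sum.inl κ)
  | Sum.inr κ => A x y a (Sum.inr κ)

/-- An average of `N` values bounded by `B` is bounded by `B`. [folklore] -/
theorem abs_avg_le {N : ℕ} [NeZero N] {v : ℕ → ℝ} {B : ℝ} (hv : ∀ s ∈ Finset.range N, |v s| ≤ B) :
    |(N : ℝ)⁻¹ * ∑ s ∈ Finset.range N, v s| ≤ B := by
  have hN : (0 : ℝ) < N := by exact_mod_cast Nat.pos_of_ne_zero (NeZero.ne N)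
  rw [abs_mul, abs_inv, abs_of_pos hN]
  calc (N : ℝ)⁻¹ * |∑ s ∈ Finset.range N, v s| ≤ (N : ℝ)⁻¹ * ∑ s ∈ Finset.range N, |v s| :=
        mul_le_mul_of_nonneg_left (Finset.abs_sum_le_sum_abs _ _) (by positivity)
    _ ≤ (N : ℝ)⁻¹ * ∑ _s ∈ Finset.range N, B := mul_le_mul_of_nonneg_left (Finset.sum_le_sum fun s hs => hv s hs) (by positivity)
    _ = B := by rw [Finset.sum_const, Finset.card_range, nsmul_eq_mul, ← mul_assoc, inv_mul_cancel₀ hN.ne', one_mul]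

/-- The contour quasi-interpolant is bounded by the bound of `J`. [folklore] -/
theorem bdd_contourRef {J : MKer (d + 1) (Fib d)} {B : ℝ} (hJ : Bdd J B) : Bdd (contourRef N J) B := by
  intro y z f b
  cases f with
  | inl κ => exact abs_avg_le fun s _ => hJ _ _ _ _
  | inr κ => exact hJ _ _ _ _

/-- The contour quasi-interpolant is bounded by the bound of `A`. [folklore] -/
theorem bdd_contourRefL {A : MKer (d + 1) (Fib d)} {B : ℝ} (hA : Bdd A B) : Bdd (contourRefL N A) B := by
  intro x y a f
  cases f with
  | inl κ => exact abs_avg_le fun s _ => hA _ _ _ _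
  | inr κ => exact hA _ _ _ _

/-- **ZERO CONTOUR SUMS ANNIHILATE THE CONTOUR QUASI-INTERPOLANT (right leg).**  If `Γ` has no multiplier columns
(`Γ x y a (inr κ) = 0`) and every field row `(κ, y) ↦ Γ x y a (inl κ)` has zero straight-contour sums, then `comp Γ (contourRef N J) = 0`
for every bounded `J` (adjointness `lip1_contourSumAdj` BY NAME). [folklore] -/
theorem comp_contourRef_eq_zero {Γ J : MKer (d + 1) (Fib d)} (hΓr : RowMaj Γ) {B : ℝ} (hJ : Bdd J B)
    (hΓm : ∀ x y a κ, Γ x y a (Sum.inr κ) = 0) (hQ : ∀ x a κ u, contourSum N (fun κ' y => Γ x y a (Sum.inl κ')) κ u = 0) :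
    comp Γ (contourRef N J) = 0 := by
  funext x z a b
  show (∑' y, ∑ f, Γ x y a f * contourRef N J y z f b) = 0
  have hrow : ∀ κ, Summable fun y => Γ x y a (Sum.inl κ) := fun κ => summable_row_of_rowMaj hΓr x a _
  have e : ∀ y, ∑ f, Γ x y a f * contourRef N J y z f b
      = ∑ κ, Γ x y a (Sum.inl κ) * contourSumAdj N (fun κ' u => (N : ℝ)⁻¹ * J ((N : ℤ) • u) z (Sum.inl κ') b) κ y := by
    intro y
    rw [Fintype.sum_sum_type]
    simp only [hΓm, zero_mul, Finset.sum_const_zero, add_zero]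
    refine Finset.sum_congr rfl fun κ _ => ?_
    simp only [contourRef, contourSumAdj, Finset.mul_sum]
    rfl
  rw [tsum_congr e]
  have h := lip1_contourSumAdj (N := N) (A := fun κ' y => Γ x y a (Sum.inl κ'))
    (φ := fun κ' u => (N : ℝ)⁻¹ * J ((N : ℤ) • u) z (Sum.inl κ') b) (M := (N : ℝ)⁻¹ * B) hrow
    (fun κ u => by rw [abs_mul, abs_inv, Nat.abs_cast]; exact mul_le_mul_of_nonneg_left (hJ _ _ _ _) (by positivity))
  simp only [lip1] at h
  rw [h]
  simp only [hQ, mul_zero, Finset.sum_const_zero, tsum_zero]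

/-- **ZERO CONTOUR SUMS ANNIHILATE THE CONTOUR QUASI-INTERPOLANT (left leg).**  If `Γ` has no multiplier rows (`Γ y z (inr κ) b = 0`)
and every field column `(κ, y) ↦ Γ y z (inl κ) b` has zero straight-contour sums, then `comp (contourRefL N A) Γ = 0`. [folklore] -/
theorem comp_contourRefL_eq_zero {A Γ : MKer (d + 1) (Fib d)} {B : ℝ} (hA : Bdd A B) (hΓc : ColMaj Γ)
    (hΓm : ∀ y z κ b, Γ y z (Sum.inr κ) b = 0) (hQ : ∀ z b κ u, contourSum N (fun κ' y => Γ y z (Sum.inl κ') b) κ u = 0) :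
    comp (contourRefL N A) Γ = 0 := by
  funext x z a b
  show (∑' y, ∑ f, contourRefL N A x y a f * Γ y z f b) = 0
  have hcol : ∀ κ, Summable fun y => Γ y z (Sum.inl κ) b := fun κ => summable_col_of_colMaj hΓc z _ b
  have e : ∀ y, ∑ f, contourRefL N A x y a f * Γ y z f b
      = ∑ κ, Γ y z (Sum.inl κ) b * contourSumAdj N (fun κ' u => (N : ℝ)⁻¹ * A x ((N : ℤ) • u) a (Sum.inl κ')) κ y := by
    intro y
    rw [Fintype.sum_sum_type]
    simp only [hΓm, mul_zero, Finset.sum_const_zero, add_zero]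
    refine Finset.sum_congr rfl fun κ _ => ?_
    rw [mul_comm]
    simp only [contourRefL, contourSumAdj, Finset.mul_sum]
    rfl
  rw [tsum_congr e]
  have h := lip1_contourSumAdj (N := N) (A := fun κ' y => Γ y z (Sum.inl κ') b)
    (φ := fun κ' u => (N : ℝ)⁻¹ * A x ((N : ℤ) • u) a (Sum.inl κ')) (M := (N : ℝ)⁻¹ * B) hcol
    (fun κ u => by rw [abs_mul, abs_inv, Nat.abs_cast]; exact mul_le_mul_of_nonneg_left (hA _ _ _ _) (by positivity))
  simp only [lip1] at h
  rw [h]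
  simp only [hQ, mul_zero, Finset.sum_const_zero, tsum_zero]

/-- **PACKAGED (right leg)**: zero contour sums of the field rows of `Γ`, no multiplier columns, oscillation `ω` of the field rows of
`J` over the contours ⇒ gain. [folklore] -/
theorem decays_comp_of_contourSum_eq_zero {Γ J : MKer (d + 1) (Fib d)} {CΓ ω δ δ' B : ℝ} (hΓ : Decays Γ CΓ δ) (hδ : 0 < δ)
    (hJ : Bdd J B) (hΓm : ∀ x y a κ, Γ x y a (Sum.inr κ) = 0)
    (hQ : ∀ x a κ u, contourSum N (fun κ' y => Γ x y a (Sum.inl κ')) κ u = 0) (hω : Decays (J - contourRef N J) ω δ)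
    (hδ'0 : 0 ≤ δ') (hδ' : δ' < δ) :
    Decays (comp Γ J) ((Fintype.card (Fib d) : ℝ) * (CΓ * ω) * Zl (d + 1) (δ - δ')) δ' :=
  have hΓs : Spr Γ := ⟨CΓ, δ, hδ, hΓ⟩
  decays_comp_of_annihil_right hΓs.tame.1 hJ (bdd_contourRef hJ) (comp_contourRef_eq_zero hΓs.tame.1 hJ hΓm hQ) hΓ hω hδ'0 hδ'

/-- **PACKAGED (left leg)**. [folklore] -/
theorem decays_comp_of_contourSum_eq_zero_left {A Γ : MKer (d + 1) (Fib d)} {CΓ ω δ δ' B : ℝ} (hA : Bdd A B)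
    (hΓ : Decays Γ CΓ δ) (hδ : 0 < δ) (hΓm : ∀ y z κ b, Γ y z (Sum.inr κ) b = 0)
    (hQ : ∀ z b κ u, contourSum N (fun κ' y => Γ y z (Sum.inl κ') b) κ u = 0) (hω : Decays (A - contourRefL N A) ω δ)
    (hδ'0 : 0 ≤ δ') (hδ' : δ' < δ) :
    Decays (comp A Γ) ((Fintype.card (Fib d) : ℝ) * (ω * CΓ) * Zl (d + 1) (δ - δ')) δ' :=
  have hΓs : Spr Γ := ⟨CΓ, δ, hδ, hΓ⟩
  decays_comp_of_annihil_left hA (bdd_contourRefL hA) hΓs.tame.2.1 (comp_contourRefL_eq_zero hA hΓs.tame.2.1 hΓm hQ) hω hΓ hδ'0 hδ'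

end Contour

end Summit.QuantumFields.BalabanUV.Beta.GAN24.WoodburyFibreZeroModeGain

end
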